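import Literature.IUT.HodgeArakelov.MonoThetaProjective

/-!
# [IUTchII] Prop. 1.6 (i) (cores) and (ii) (elliptic cuspidalisations): kernel inhabitant /
# consistency form of the typed OUTPUT structures (proof-only companion)

PROOF-ONLY companion (theorems only; no `def`, no new named fact, no statement re-typed) of the landed,
frozen `MonoThetaProjective.lean` (abc-iut-L6-t1, p407497). abc-iut cell, wave-5 seat abc-iut-w5-d030,
DAG nodes **IUTchII:Prop1.6(i)** and **IUTchII:Prop1.6(ii)** (layer L6, outside the [IUTchIII] Cor. 3.12
cone). S. Mochizuki, *Inter-universal Teichmüller theory II*, kurims manuscript (Dec. 2020), §1,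
Proposition 1.6, p. 31 l. 16 (i) "(Cores) There exists a functorial group-theoretic algorithm [cf.
[AbsTopII], Corollary 3.3, (i); [AbsTopII], Remark 3.3.3] `Π ↦ {(Π ⊆) Π_C(Π) ↠ Π/Δ}` […]" and l. 34 (ii)
"(Elliptic Cuspidalizations) Let `N` be a positive integer. Then there exists a functorial group-theoretic
algorithm [cf. [AbsTopII], Corollary 3.3, (iii); [AbsTopII], Remark 3.3.3] `Π ↦ {Π_{U_N}(Π) ↠ Π}` […]"
[claim: Mochizuki2012, status: disputed] (IUTchII §1 Prop 1.6, kurims p.31); the printed proof (p. 31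
l. 51–53, verbatim from the kurims render paper:url-5036b4059555 p0031) reads "The assertions of
Proposition 1.6 follow immediately from the results of [AbsTopII] that are quoted in the statements of these
assertions [cf. also Remark 1.6.1 below]."; the characteristic subgroup is print's l. 10–12 "Write `Δ ⊆ Π`
for the [group-theoretic! — cf., e.g., [AbsAnab], Lemma 1.3.8] subgroup corresponding to `Δ^tp_{X̲̲_k}`."
(TRANSPARENCY, doc-only v2 of p412824: v1's header l. 13–14 carried the generic formula «immediate from the
definitions and the references quoted» as if it were this proof sentence and dropped the two «[AbsTopII],
Remark 3.3.3» citations — quotation-fidelity defect #174 flagged by referee lane P 2026-08-26T00:07:36Z and by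
abc-iut-w5-d137's RQ7 pass F1; repaired here by the verbatim sentence; no declaration changed.)

## What the typer froze, and what is proved here

The frozen file types Prop. 1.6 by its OUTPUT: structures `CoreData S P` (fields `Delta`,
`Delta_corresponds : ∀ e : P ≃ₜ* Π^tp, Delta.map e = Δ^tp`, `PiC ⊇ P` open, augmentation
`augC : PiC ↠ P/Delta`, reference datum `PiCRef, inclRef`, and `identified`) and
`EllipticCuspidalization S N P` (fields `PiU ↠ P`, reference datum `PiURef, projRef`, `identified`),
with the existence clause deliberately NOT typed as a named fact (frozen docstring: "over an axiom-free
interface the transport form is trivially provable and the unguarded form is false for junk settings").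
The deliverable for such OUTPUT-structure nodes is the kernel INHABITANT / consistency form
(abc-iut-L5-lead ruling 2026-08-25T23:21:23Z (A)/(C), applied to L6 by abc-iut-w5-d030):

* `CoreData.deltaX_map_eq_of_coreData` — NECESSITY: if `CoreData S P` is inhabited then `Δ^tp_{X̲̲_k}` is
  stable under EVERY topological automorphism of `Π^tp_{X̲̲_k}` (the printed "[group-theoretic! — cf.
  [AbsAnab], Lemma 1.3.8]" input is forced by the field `Delta_corresponds`);
* `CoreData.nonempty_of_core` — SUFFICIENCY in reference form: given that characteristic-subgroup input
  and ANY open over-group `Π ⊆ Π_C` carrying a compatible continuous surjection `Π_C ↠ Π/Δ` (the shape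
  of the genuine core `Π^tp_{X̲̲_k} ⊆ Π^tp_{C_k}`), the structure is inhabited for every `P ≃ₜ* Π^tp` with
  `PiC = PiCRef =` that over-group;
* `CoreData.nonempty_iff` — the EXACT CONTENT of the typed (i):
  `Nonempty (CoreData S P) ↔ Nonempty (P ≃ₜ* S.PiX) ∧ ∀ φ, S.DeltaX.map φ = S.DeltaX`;
* `CoreData.nonempty_transport` — functoriality ("functorial algorithm") as transport along `P ≃ₜ* P'`,
  keeping `PiC`/`PiCRef`;
* `CoreData.delta_eq_comap`, `CoreData.comap_incl_deltaC` — consistency: the typed `Δ` is pinned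
  (`Δ = e⁻¹(Δ^tp)` for every reference isomorphism) and `Δ_C(Π) ∩ Π = Δ` ("compatible with the
  respective surjections to `Π/Δ`");
* `EllipticCuspidalization.nonempty_of_reference`, `.nonempty_iff`, `.nonempty_iff_of_label`,
  `.nonempty_transport` — the same four items for (ii). NOTE (RQ7-genre, neutral, for the typer
  abc-iut-L6-t1 and the MERGE-MAP row 92 owner): AS TYPED, `EllipticCuspidalization S N P` is inhabited as
  soon as `P ≃ₜ* Π^tp` is (take `Π_{U_N}(Π) := Π`), uniformly in the label `N` — the frozen docstring says so
  in prose ("formally `N` is a LABEL only […], to be tied to the `N`-torsion open immersion at merge"); the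
  kernel form below makes the merge debt visible: the content of (ii) enters only when `projRef` is pinned
  to abc-iut-L4-t6's `AbsTopII.EllipticCuspidalization` ([AbsTopII] Cor. 3.3 (iii)).

Nothing here constructs the genuine tempered core `Π^tp_{C_k}` or the genuine `Π^tp_{U_N}` (interface data of
other layers: HOME/plan/L6/MERGE-MAP.md rows 91/92); the theorems are about the frozen interfaces only.

HONEST FRAMING: the claim key `Mochizuki2012` is DISPUTED (D-0012); this file asserts no [IUTchII]
statement beyond what the typed structures contain; nothing here takes a side on [IUTchIII] Cor. 3.12;
typed ≠ discharged elsewhere.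
-/

namespace Literature.IUT.HodgeArakelov

universe u

open Topology

variable {S : ThetaSetting.{u}} {P P' : TopGroup.{u}}

/-! ## Bookkeeping on subgroups transported along (continuous) group isomorphisms -/

/-- The group homomorphism underlying a continuous multiplicative equivalence has the same underlying
function. [claim: Mochizuki2012, status: disputed] (IUTchII §1 Prop 1.6 (i), kurims p.31) -/
theorem coe_toMulEquiv_toMonoidHom {A B : Type u} [Group A] [Group B] [TopologicalSpace A]
    [TopologicalSpace B] (e : A ≃ₜ* B) : ⇑e.toMulEquiv.toMonoidHom = ⇑e := rfl

/-- Transport of a subgroup along a composite of continuous multiplicative equivalences.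
[claim: Mochizuki2012, status: disputed] (IUTchII §1 Prop 1.6 (i), kurims p.31) -/
theorem subgroup_map_trans {A B C : Type u} [Group A] [Group B] [Group C] [TopologicalSpace A]
    [TopologicalSpace B] [TopologicalSpace C] (H : Subgroup A) (e : A ≃ₜ* B) (f : B ≃ₜ* C) :
    H.map (e.trans f).toMulEquiv.toMonoidHom = (H.map e.toMulEquiv.toMonoidHom).map
      f.toMulEquiv.toMonoidHom := by
  rw [Subgroup.map_map]
  rfl

/-- Pulling back a subgroup along a continuous multiplicative equivalence is pushing it forward along the
inverse. [claim: Mochizuki2012, status: disputed] (IUTchII §1 Prop 1.6 (i), kurims p.31) -/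
theorem subgroup_comap_eq_map_symm {A B : Type u} [Group A] [Group B] [TopologicalSpace A]
    [TopologicalSpace B] (H : Subgroup B) (e : A ≃ₜ* B) :
    H.comap e.toMulEquiv.toMonoidHom = H.map e.symm.toMulEquiv.toMonoidHom := by
  ext x
  constructor
  · intro hx
    refine ⟨e x, hx, ?_⟩
    change e.symm (e x) = x
    exact e.symm_apply_apply x
  · rintro ⟨y, hy, rfl⟩
    change e (e.symm y) ∈ H
    rw [e.apply_symm_apply]
    exact hy

namespace CoreData

/-! ## Prop. 1.6 (i): cores -/

/-- **Necessity of the [AbsAnab] Lem. 1.3.8 input.** If the typed Prop. 1.6 (i) output `CoreData S P` is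
inhabited, then `Δ^tp_{X̲̲_k} = Ker(Π^tp_{X̲̲_k} ↠ G_k)` is stable under every topological automorphism of
`Π^tp_{X̲̲_k}` — forced by the frozen field `Delta_corresponds` (quantified over ALL reference
isomorphisms), i.e. the printed "[group-theoretic! — cf., e.g., [AbsAnab], Lemma 1.3.8] subgroup
corresponding to `Δ^tp_{X̲̲_k}`". [claim: Mochizuki2012, status: disputed] (IUTchII §1 Prop 1.6 (i), kurims p.31) -/
theorem deltaX_map_eq_of_coreData (C : CoreData S P) (φ : S.PiX ≃ₜ* S.PiX) :
    S.DeltaX.map φ.toMulEquiv.toMonoidHom = S.DeltaX := by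
  obtain ⟨e⟩ := C.isoRef
  have h1 := C.Delta_corresponds e
  have h2 := C.Delta_corresponds (e.trans φ)
  rw [subgroup_map_trans, h1] at h2
  exact h2

/-- **Consistency: the typed `Δ` is pinned.** For every reference isomorphism `e : Π ⥲ Π^tp_{X̲̲_k}` the
field `Delta` of a `CoreData` IS `e⁻¹(Δ^tp_{X̲̲_k})`. [claim: Mochizuki2012, status: disputed] (IUTchII §1 Prop 1.6 (i), kurims p.31) -/
theorem delta_eq_comap (C : CoreData S P) (e : P ≃ₜ* S.PiX) :
    C.Delta = S.DeltaX.comap e.toMulEquiv.toMonoidHom := by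
  have h := C.Delta_corresponds e
  rw [← h, Subgroup.comap_map_eq_self_of_injective]
  exact e.injective

/-- **Consistency: "compatible with the respective surjections to `Π/Δ`"** — `Δ_C(Π) ∩ Π = Δ`: the inverse
image of `Δ_C(Π) = Ker(Π_C(Π) ↠ Π/Δ)` under `Π ⊆ Π_C(Π)` is `Δ`. [claim: Mochizuki2012, status: disputed] (IUTchII §1 Prop 1.6 (i), kurims p.31) -/
theorem comap_incl_deltaC (C : CoreData S P) : C.DeltaC.comap C.incl = C.Delta := by
  ext x
  simp only [Subgroup.mem_comap, MonoidHom.mem_ker, C.augC_compat, QuotientGroup.eq_one_iff]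

/-- **Sufficiency, reference form (the genuine shape).** Given the [AbsAnab] Lem. 1.3.8 input (`Δ^tp`
topologically characteristic) and ANY topological over-group `ι : Π^tp_{X̲̲_k} ↪ Π_C` that is an open
embedding together with a continuous surjection `a : Π_C ↠ Π^tp/Δ^tp` compatible with `Π^tp ↠ Π^tp/Δ^tp`
(the shape of the genuine core `Π^tp_{X̲̲_k} ⊆ Π^tp_{C_k} ↠ G_k`), the typed Prop. 1.6 (i) output is
inhabited for every `P ≃ₜ* Π^tp_{X̲̲_k}`, with `Π_C(Π) := Π_C` and reference datum `Π_C`.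
[claim: Mochizuki2012, status: disputed] (IUTchII §1 Prop 1.6 (i), kurims p.31) -/
theorem nonempty_of_core (e : P ≃ₜ* S.PiX)
    (hchar : ∀ φ : S.PiX ≃ₜ* S.PiX, S.DeltaX.map φ.toMulEquiv.toMonoidHom = S.DeltaX)
    {Cref : TopGroup.{u}} (ι : S.PiX →* Cref) (hι : IsOpenEmbedding ι)
    (a : Cref →* S.PiX ⧸ S.DeltaX) (ha : Continuous a) (hs : Function.Surjective a)
    (hc : ∀ x : S.PiX, a (ι x) = QuotientGroup.mk x) :
    ∃ C : CoreData S P, C.PiC = Cref ∧ C.PiCRef = Cref := by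
  classical
  -- the transported `Δ ⊆ P`
  let D : Subgroup P := S.DeltaX.comap e.toMulEquiv.toMonoidHom
  -- `Π^tp/Δ^tp → P/Δ` induced by `e⁻¹`
  have hle : S.DeltaX ≤ D.comap e.symm.toMulEquiv.toMonoidHom := by
    intro y hy
    change e (e.symm y) ∈ S.DeltaX
    rw [e.apply_symm_apply]
    exact hy
  let q : S.PiX ⧸ S.DeltaX →* P ⧸ D := QuotientGroup.map S.DeltaX D e.symm.toMulEquiv.toMonoidHom hle
  have hq_mk : ∀ y : S.PiX, q (QuotientGroup.mk y) = QuotientGroup.mk (e.symm y) := fun y => rfl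
  have hq_cont : Continuous q := by
    refine (QuotientGroup.isQuotientMap_mk S.DeltaX).continuous_iff.2 ?_
    have : (q ∘ QuotientGroup.mk : S.PiX → P ⧸ D) = QuotientGroup.mk ∘ e.symm := by
      funext y
      exact hq_mk y
    rw [this]
    exact QuotientGroup.continuous_mk.comp e.symm.continuous
  have hq_surj : Function.Surjective q := by
    intro z
    obtain ⟨x, rfl⟩ := QuotientGroup.mk_surjective z
    refine ⟨QuotientGroup.mk (e x), ?_⟩
    rw [hq_mk, e.symm_apply_apply]
  refine ⟨{ isoRef := ⟨e⟩
            Delta := D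
            Delta_normal := inferInstance
            Delta_corresponds := ?_
            PiC := Cref
            incl := ι.comp e.toMulEquiv.toMonoidHom
            incl_isOpenEmbedding := ?_
            augC := q.comp a
            augC_continuous := hq_cont.comp ha
            augC_surjective := hq_surj.comp hs
            augC_compat := ?_
            PiCRef := Cref
            inclRef := ι
            identified := ⟨e, ContinuousMulEquiv.refl Cref, fun x => rfl⟩ }, rfl, rfl⟩
  · intro e'
    change (S.DeltaX.comap e.toMulEquiv.toMonoidHom).map e'.toMulEquiv.toMonoidHom = S.DeltaX
    rw [subgroup_comap_eq_map_symm, ← subgroup_map_trans]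
    exact hchar (e.symm.trans e')
  · exact hι.comp e.toHomeomorph.isOpenEmbedding
  · intro x
    change q (a (ι (e x))) = _
    rw [hc, hq_mk, e.symm_apply_apply]

/-- **Exact content of the typed Prop. 1.6 (i) output** (kernel inhabitant form): `CoreData S P` is
inhabited if and only if `P ≅ Π^tp_{X̲̲_k}` as topological groups AND `Δ^tp_{X̲̲_k}` is stable under every
topological automorphism of `Π^tp_{X̲̲_k}` (the [AbsAnab] Lem. 1.3.8 input, by name). The "if" direction
is witnessed with `Π_C(Π) := Π^tp` itself — the structure does not pin the core beyond its reference datum.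
[claim: Mochizuki2012, status: disputed] (IUTchII §1 Prop 1.6 (i), kurims p.31) -/
theorem nonempty_iff : Nonempty (CoreData S P) ↔
    Nonempty (P ≃ₜ* S.PiX) ∧
      ∀ φ : S.PiX ≃ₜ* S.PiX, S.DeltaX.map φ.toMulEquiv.toMonoidHom = S.DeltaX := by
  constructor
  · rintro ⟨C⟩
    exact ⟨C.isoRef, deltaX_map_eq_of_coreData C⟩
  · rintro ⟨⟨e⟩, hchar⟩
    obtain ⟨C, -, -⟩ := nonempty_of_core (P := P) e hchar (Cref := S.PiX) (MonoidHom.id _)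
      IsOpenEmbedding.id (QuotientGroup.mk' S.DeltaX) QuotientGroup.continuous_mk
      QuotientGroup.mk_surjective (fun _ => rfl)
    exact ⟨C⟩

/-- **Functoriality as transport.** A `CoreData` over `P` transports along any `P ≃ₜ* P'` to a `CoreData`
over `P'` with the SAME `Π_C(·)` and the same reference datum ("functorial group-theoretic algorithm").
[claim: Mochizuki2012, status: disputed] (IUTchII §1 Prop 1.6 (i), kurims p.31) -/
theorem nonempty_transport (C : CoreData S P) (f : P ≃ₜ* P') :
    ∃ C' : CoreData S P', C'.PiC = C.PiC ∧ C'.PiCRef = C.PiCRef := by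
  classical
  let D : Subgroup P' := C.Delta.comap f.symm.toMulEquiv.toMonoidHom
  have hle : C.Delta ≤ D.comap f.toMulEquiv.toMonoidHom := by
    intro x hx
    change f.symm (f x) ∈ C.Delta
    rw [f.symm_apply_apply]
    exact hx
  let q : P ⧸ C.Delta →* P' ⧸ D := QuotientGroup.map C.Delta D f.toMulEquiv.toMonoidHom hle
  have hq_mk : ∀ x : P, q (QuotientGroup.mk x) = QuotientGroup.mk (f x) := fun x => rfl
  have hq_cont : Continuous q := by
    refine (QuotientGroup.isQuotientMap_mk C.Delta).continuous_iff.2 ?_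
    have : (q ∘ QuotientGroup.mk : P → P' ⧸ D) = QuotientGroup.mk ∘ f := by
      funext x
      exact hq_mk x
    rw [this]
    exact QuotientGroup.continuous_mk.comp f.continuous
  have hq_surj : Function.Surjective q := by
    intro z
    obtain ⟨x', rfl⟩ := QuotientGroup.mk_surjective z
    refine ⟨QuotientGroup.mk (f.symm x'), ?_⟩
    rw [hq_mk, f.apply_symm_apply]
  obtain ⟨e, eC, heC⟩ := C.identified
  refine ⟨{ isoRef := ⟨f.symm.trans e⟩
            Delta := D
            Delta_normal := inferInstance
            Delta_corresponds := ?_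
            PiC := C.PiC
            incl := C.incl.comp f.symm.toMulEquiv.toMonoidHom
            incl_isOpenEmbedding := ?_
            augC := q.comp C.augC
            augC_continuous := hq_cont.comp C.augC_continuous
            augC_surjective := hq_surj.comp C.augC_surjective
            augC_compat := ?_
            PiCRef := C.PiCRef
            inclRef := C.inclRef
            identified := ⟨f.symm.trans e, eC, fun x' => heC (f.symm x')⟩ }, rfl, rfl⟩
  · intro e'
    change (C.Delta.comap f.symm.toMulEquiv.toMonoidHom).map e'.toMulEquiv.toMonoidHom = S.DeltaX
    rw [subgroup_comap_eq_map_symm, ← subgroup_map_trans]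
    exact C.Delta_corresponds _
  · exact C.incl_isOpenEmbedding.comp f.symm.toHomeomorph.isOpenEmbedding
  · intro x'
    change q (C.augC (C.incl (f.symm x'))) = _
    rw [C.augC_compat, hq_mk, f.apply_symm_apply]

end CoreData

namespace EllipticCuspidalization

/-! ## Prop. 1.6 (ii): elliptic cuspidalisations -/

variable {N N' : ℕ+}

/-- **Sufficiency, reference form.** Given ANY continuous surjection `π : Π_U ↠ Π^tp_{X̲̲_k}` (the shape of
the genuine elliptic cuspidalisation `Π^tp_{U_N} ↠ Π^tp_{X̲̲_k}` of [AbsTopII] Cor. 3.3 (iii)), the typed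
Prop. 1.6 (ii) output is inhabited for every `P ≃ₜ* Π^tp_{X̲̲_k}`, with `Π_{U_N}(Π) := Π_U` and reference
datum `Π_U`. [claim: Mochizuki2012, status: disputed] (IUTchII §1 Prop 1.6 (ii), kurims p.31) -/
theorem nonempty_of_reference (e : P ≃ₜ* S.PiX) {Uref : TopGroup.{u}} (π : Uref →* S.PiX)
    (hπ : Continuous π) (hs : Function.Surjective π) :
    ∃ E : EllipticCuspidalization S N P, E.PiU = Uref ∧ E.PiURef = Uref := by
  refine ⟨{ isoRef := ⟨e⟩
            PiU := Uref
            proj := e.symm.toMulEquiv.toMonoidHom.comp π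
            proj_continuous := e.symm.continuous.comp hπ
            proj_surjective := e.symm.surjective.comp hs
            PiURef := Uref
            projRef := π
            identified := ⟨e, ContinuousMulEquiv.refl Uref, fun y => ?_⟩ }, rfl, rfl⟩
  change π y = e (e.symm (π y))
  rw [e.apply_symm_apply]

/-- **Exact content of the typed Prop. 1.6 (ii) output** (kernel inhabitant form; RQ7-genre note for the
merge): AS TYPED, `EllipticCuspidalization S N P` is inhabited if and only if `P ≅ Π^tp_{X̲̲_k}` — the "if"
direction is witnessed with `Π_{U_N}(Π) := Π` and the identity as reference surjection, so the structure
carries no content beyond `isoRef` until `projRef` is pinned to the genuine elliptic cuspidalisation of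
[AbsTopII] Cor. 3.3 (iii) (abc-iut-L4-t6) at merge, exactly as the frozen docstring announces.
[claim: Mochizuki2012, status: disputed] (IUTchII §1 Prop 1.6 (ii), kurims p.31) -/
theorem nonempty_iff : Nonempty (EllipticCuspidalization S N P) ↔ Nonempty (P ≃ₜ* S.PiX) := by
  constructor
  · rintro ⟨E⟩
    exact E.isoRef
  · rintro ⟨e⟩
    obtain ⟨E, -, -⟩ := nonempty_of_reference (N := N) e (Uref := S.PiX) (MonoidHom.id _)
      continuous_id Function.surjective_id
    exact ⟨E⟩

/-- **`N` is a label only** (kernel form of the frozen docstring's remark): inhabitation of the typed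
(ii) output does not depend on `N`. [claim: Mochizuki2012, status: disputed] (IUTchII §1 Prop 1.6 (ii), kurims p.31) -/
theorem nonempty_iff_of_label :
    Nonempty (EllipticCuspidalization S N P) ↔ Nonempty (EllipticCuspidalization S N' P) := by
  rw [nonempty_iff, nonempty_iff]

/-- **Functoriality as transport.** An `EllipticCuspidalization` over `P` transports along any
`P ≃ₜ* P'` to one over `P'` with the SAME `Π_{U_N}(·)` and the same reference datum.
[claim: Mochizuki2012, status: disputed] (IUTchII §1 Prop 1.6 (ii), kurims p.31) -/
theorem nonempty_transport (E : EllipticCuspidalization S N P) (f : P ≃ₜ* P') :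
    ∃ E' : EllipticCuspidalization S N P', E'.PiU = E.PiU ∧ E'.PiURef = E.PiURef := by
  obtain ⟨e, eU, heU⟩ := E.identified
  refine ⟨{ isoRef := ⟨f.symm.trans e⟩
            PiU := E.PiU
            proj := f.toMulEquiv.toMonoidHom.comp E.proj
            proj_continuous := f.continuous.comp E.proj_continuous
            proj_surjective := f.surjective.comp E.proj_surjective
            PiURef := E.PiURef
            projRef := E.projRef
            identified := ⟨f.symm.trans e, eU, fun y => ?_⟩ }, rfl, rfl⟩
  rw [heU]
  change e (E.proj y) = e (f.symm (f (E.proj y)))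
  rw [f.symm_apply_apply]

end EllipticCuspidalization

end Literature.IUT.HodgeArakelov
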